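import Summits.MatrixMultiplication.MatrixMultiplication.Theorems.TetrahedronTensorKronecker
import Literature.Computability.AlgebraicComplexity.RectangularExponentHomogeneity
import Literature.Computability.AlgebraicComplexity.RectangularExponentInformationBound
import HarnessLib

/-!
# Tetrahedron tensor — grouping two vertices: `ω(2,1,2) ≤ ω(K₄)`

What the attacked conjunct `TetraFlat : ω(K₄) ≤ 4` of the tetrahedron carving gives ON ITS OWN
(decomp-mm lens 6, g13, tag «WEAKER»): grouping the vertices `{0,1}` of `K₄` into one party and
freezing the label of the edge `01` turns `T(K₄)_N` into the rectangular matrix multiplication tensor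
`⟨N², N, N²⟩` (edges `02,12` between the group and vertex `2`, edge `23`, edges `03,13` between the
group and vertex `3`), and a 4-party rank-one decomposition restricts to a 3-party one. Hence

* `tensorRank_matMulTensor_le_tensorRankD_tetra : R(⟨N², N, N²⟩) ≤ R₄(T(K₄)_N)` (`N ≥ 1`);
* `tetraAdmissibleExponents_subset_rect`, `omegaRect_two_one_two_le_omegaTetra : ω(2,1,2) ≤ ω(K₄)`;
* `four_le_omegaRect_two_one_two : 4 ≤ ω(2,1,2)` (information bound),
  `omegaRect_two_one_two_eq_four_of_omegaTetra_le_four : ω(K₄) ≤ 4 → ω(2,1,2) = 4`, the symmetric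
  form `ω(1,2,2) = 4`, the homogeneous form `omegaRect_one_half_one_eq_two_of_omegaTetra_le_four :
  ω(K₄) ≤ 4 → ω(1,½,1) = 2` and `half_le_dualExponentAlpha_of_omegaTetra_le_four : ω(K₄) ≤ 4 → ½ ≤ α`.

So `TetraFlat` alone yields `ω(2,1,2) = 4` (equivalently `ω(1,1,1/2) = 2`, dual exponent `α ≥ 1/2`;
the record is `α > 0.321334`), an open statement strictly short of `ω = 2` as far as anyone knows.
Sorry-free.
-/

noncomputable section

set_option linter.dupNamespace false

namespace Summit.MatrixMultiplication.MatrixMultiplication.Theorems.TetrahedronTensor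

open Filter Asymptotics
open Literature.Computability.AlgebraicComplexity

/-! ## The rank inequality `R(⟨N², N, N²⟩) ≤ R₄(T(K₄)_N)` -/

section Grouping

variable {F : Type*} [Field F]

/-- The vertex label triples of `K₄` read off a point `(a, b, c)` of `⟨N², N, N²⟩`
(`a = (κ, ν)`, `b = (κ', μ)`, `c = (μ', ν')`, pair labels `Fin (N·N) ≃ Fin N × Fin N`): edge `01`
frozen to `0`, `(e₀₂, e₁₂) = κ` resp. `κ'`, `(e₀₃, e₁₃) = ν` resp. `ν'`, `e₂₃ = μ` resp. `μ'`. -/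
def groupLabels {N : ℕ} [NeZero N] (a : Fin (N * N) × Fin (N * N)) (b : Fin (N * N) × Fin N)
    (c : Fin N × Fin (N * N)) : Fin 4 → Fin 3 → Fin N :=
  ![![0, (finProdFinEquiv.symm a.1).1, (finProdFinEquiv.symm a.2).1],
    ![0, (finProdFinEquiv.symm a.1).2, (finProdFinEquiv.symm a.2).2],
    ![(finProdFinEquiv.symm b.1).1, (finProdFinEquiv.symm b.1).2, b.2],
    ![(finProdFinEquiv.symm c.2).1, (finProdFinEquiv.symm c.2).2, c.1]]

/-- **The grouped tetrahedron is `⟨N², N, N²⟩`**: at the leg indices encoded by `groupLabels a b c`,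
`T(K₄)_N` takes the value `⟨N², N, N²⟩(a, b, c)`. [folklore] -/
theorem tetra_groupLabels {N : ℕ} [NeZero N] (a : Fin (N * N) × Fin (N * N))
    (b : Fin (N * N) × Fin N) (c : Fin N × Fin (N * N)) :
    tetra F N (fun v => enc (groupLabels a b c v 0) (groupLabels a b c v 1) (groupLabels a b c v 2)) =
      matMulTensor F (N * N) N (N * N) a b c := by
  have e : ∀ x y : Fin (N * N), x = y ↔
      ((finProdFinEquiv.symm x).1 = (finProdFinEquiv.symm y).1 ∧
        (finProdFinEquiv.symm x).2 = (finProdFinEquiv.symm y).2) := fun x y => by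
    rw [← Prod.ext_iff, Equiv.apply_eq_iff_eq]
  rw [tetra_apply_enc]
  simp only [matMulTensor]
  refine if_congr ?_ rfl rfl
  simp only [consistent_iff, groupLabels, Matrix.cons_val_zero, Matrix.cons_val_one,
    Matrix.cons_val_two, Matrix.cons_val_three, Matrix.head_cons, Matrix.tail_cons, e,
    true_and]
  tauto

/-- **Grouping lower-bound transfer** `R(⟨N², N, N²⟩) ≤ R₄(T(K₄)_N)` (`N ≥ 1`): a rank-one
decomposition `T(K₄)_N = ∑_k ⊗_v u_k(v)` restricts, along `groupLabels`, to the triad decomposition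
`⟨N²,N,N²⟩ = ∑_k (u_k(0) u_k(1))|_{e₀₁ = 0} ⊗ u_k(2) ⊗ u_k(3)`. [folklore] -/
theorem tensorRank_matMulTensor_le_tensorRankD_tetra (N : ℕ) [NeZero N] :
    tensorRank (matMulTensor F (N * N) N (N * N)) ≤ tensorRankD (tetra F N) := by
  classical
  obtain ⟨u, hu⟩ := exists_rankOne_decomposition_tetra (F := F) N
  refine tensorRank_le_of_eq_sum
    (fun k (a : Fin (N * N) × Fin (N * N)) =>
      u k 0 (enc 0 (finProdFinEquiv.symm a.1).1 (finProdFinEquiv.symm a.2).1) *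
        u k 1 (enc 0 (finProdFinEquiv.symm a.1).2 (finProdFinEquiv.symm a.2).2))
    (fun k (b : Fin (N * N) × Fin N) =>
      u k 2 (enc (finProdFinEquiv.symm b.1).1 (finProdFinEquiv.symm b.1).2 b.2))
    (fun k (c : Fin N × Fin (N * N)) =>
      u k 3 (enc (finProdFinEquiv.symm c.2).1 (finProdFinEquiv.symm c.2).2 c.1)) ?_
  funext a b c
  have hpt := congrFun hu
    (fun v => enc (groupLabels a b c v 0) (groupLabels a b c v 1) (groupLabels a b c v 2))
  rw [Finset.sum_apply, tetra_groupLabels] at hpt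
  rw [← hpt, Finset.sum_apply, Finset.sum_apply, Finset.sum_apply]
  refine Finset.sum_congr rfl fun k _ => ?_
  rw [rankOneTensor_apply, Fin.prod_univ_four, triad_apply]
  simp only [groupLabels, Matrix.cons_val_zero, Matrix.cons_val_one, Matrix.cons_val_two,
    Matrix.cons_val_three, Matrix.head_cons, Matrix.tail_cons]

end Grouping

/-! ## The exponent inequality `ω(2,1,2) ≤ ω(K₄)` -/

section Exponent

variable (F : Type) [Field F]

/-- Every admissible exponent of `T(K₄)` is admissible for `(2,1,2)`-rectangular matrix
multiplication (`⌈n²⌉ = n·n`, `⌈n¹⌉ = n`, and the grouping transfer). [folklore] -/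
theorem tetraAdmissibleExponents_subset_rect :
    tetraAdmissibleExponents F ⊆ rectAdmissibleExponents F 2 1 2 := by
  intro β hβ
  refine IsBigO.trans ?_ hβ
  refine IsBigO.of_bound 1 ?_
  filter_upwards [eventually_ge_atTop 1] with n hn
  rw [one_mul, Real.norm_of_nonneg (Nat.cast_nonneg _), Real.norm_of_nonneg (Nat.cast_nonneg _)]
  haveI : NeZero n := ⟨by omega⟩
  have h2 : rectDim n 2 = n * n := by
    rw [show (2 : ℝ) = ((2 : ℕ) : ℝ) by norm_num, rectDim_natCast, pow_two]
  have h1 : rectDim n 1 = n := rectDim_one n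
  rw [tensorRank_matMulTensor_congr F h2 h1 h2]
  exact_mod_cast tensorRank_matMulTensor_le_tensorRankD_tetra (F := F) n

/-- **`ω(2,1,2) ≤ ω(K₄)`** (grouping two vertices of the tetrahedron). [folklore] -/
theorem omegaRect_two_one_two_le_omegaTetra : omegaRect F 2 1 2 ≤ omegaTetra F :=
  csInf_le_csInf (rectAdmissibleExponents_bddBelow F 2 1 2) (tetraAdmissibleExponents_nonempty F)
    (tetraAdmissibleExponents_subset_rect F)

/-- **`4 ≤ ω(2,1,2)`** (information bound along the outer slots). [cite: HuangPan1998, §2 eq. (2.8) (p. 262)] -/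
theorem four_le_omegaRect_two_one_two : 4 ≤ omegaRect F 2 1 2 := by
  have h := add_le_omegaRect₁₃ F 2 1 2
  norm_num at h
  exact h

/-- **`TetraFlat` alone**: `ω(K₄) ≤ 4 → ω(2,1,2) = 4` (equivalently `ω(1,1,½) = 2`, `α ≥ ½`).
[folklore] -/
theorem omegaRect_two_one_two_eq_four_of_omegaTetra_le_four (h : omegaTetra F ≤ 4) :
    omegaRect F 2 1 2 = 4 :=
  le_antisymm ((omegaRect_two_one_two_le_omegaTetra F).trans h) (four_le_omegaRect_two_one_two F)

/-- Symmetric form: `ω(K₄) ≤ 4 → ω(1,2,2) = 4`. [folklore] -/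
theorem omegaRect_one_two_two_eq_four_of_omegaTetra_le_four (h : omegaTetra F ≤ 4) :
    omegaRect F 1 2 2 = 4 := by
  rw [← omegaRect_swap₁₂ F 2 1 2]
  exact omegaRect_two_one_two_eq_four_of_omegaTetra_le_four F h

/-- **Dual-exponent form**: `ω(K₄) ≤ 4 → ω(1, ½, 1) = 2` (homogeneity `ω(2,1,2) = 2·ω(1,½,1)`).
[folklore] -/
theorem omegaRect_one_half_one_eq_two_of_omegaTetra_le_four (h : omegaTetra F ≤ 4) :
    omegaRect F 1 (1 / 2) 1 = 2 := by
  have hs := omegaRect_smul (K := F) (t := 2) (by norm_num) (a := 1) (b := 1 / 2) (c := 1)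
    (by norm_num) (by norm_num) (by norm_num)
  have h2 : ((2 : ℕ) : ℝ) * (1 / 2) = 1 := by norm_num
  have h1 : ((2 : ℕ) : ℝ) * 1 = 2 := by norm_num
  rw [h2, h1] at hs
  have h4 := omegaRect_two_one_two_eq_four_of_omegaTetra_le_four F h
  rw [h4] at hs
  have h22 : ((2 : ℕ) : ℝ) = 2 := by norm_num
  rw [h22] at hs
  linarith

/-- **`TetraFlat` alone gives `α ≥ ½`**: `ω(K₄) ≤ 4 → ½ ≤ α` (the dual exponent of matrix
multiplication; record `α > 0.321334`). [folklore] -/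
theorem half_le_dualExponentAlpha_of_omegaTetra_le_four (h : omegaTetra F ≤ 4) :
    1 / 2 ≤ dualExponentAlpha F :=
  le_dualExponentAlpha (K := F) ⟨by norm_num, by norm_num⟩
    (omegaRect_one_half_one_eq_two_of_omegaTetra_le_four F h)

/-- Bracket `4 ≤ ω(2,1,2) ≤ ω(K₄) ≤ 2ω`. [folklore] -/
theorem omegaRect_two_one_two_bracket :
    4 ≤ omegaRect F 2 1 2 ∧ omegaRect F 2 1 2 ≤ omegaTetra F ∧ omegaTetra F ≤ 2 * omega F :=
  ⟨four_le_omegaRect_two_one_two F, omegaRect_two_one_two_le_omegaTetra F,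
    omegaTetra_le_two_mul_omega F⟩

end Exponent

end Summit.MatrixMultiplication.MatrixMultiplication.Theorems.TetrahedronTensor

end
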